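import Mathlib
import Literature.NumberTheory.LFunctions.Zhang2022.Section17SummedError
import HarnessLib

/-!
# Zhang (2022) §17: `nN_β(n) = n^{−β}g*(T²/n) = 1 + O(|β|log n + e^{−𝓛³⁰})` on the WHOLE range `n ≤ T²/e`

Topic `Literature/NumberTheory/LFunctions/Zhang2022` (Landau–Siegel audit tree; verdict-neutral).
Y. Zhang, *Discrete mean estimates and the Landau–Siegel zero*, arXiv:2211.02515v1 (2022)
[Zhang2022LandauSiegel] — **an unrefereed manuscript under adjudication**; nothing here asserts or denies
its Theorems 1–2. §17 p. 97 (u014: `N(s+β_j,ψ) = Σ n^{−s}·nN_{β_j}(n)ψ(n)`, `nN_β(n) = n^{−β}g*(T²/n)`) with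
§4 (4.2) (the Gaussian weight `g`). The tree's `Phi3Eval.norm_nN_sub_one_le` (`Section17SummedError`)
gives `|nN_β(n) − 1| ≤ 21α𝓛` for `n ≤ D⁴`; THIS FILE records the same estimate on the whole range below
the cutoff, `e·n ≤ T²`, in the generic form the §17.u021 remainder `R₁` needs (MEMO-R1-window §2(i):
"`m₂ ≤ T²/(4D⁴)`: all cutoffs `g ≡ 1` up to `e^{−𝓛³⁰}`"):

* `norm_nN_sub_one_le_of_mul_le` — for `β` purely imaginary, `𝓛 ≥ 1`, `n ≥ 1`, `e·n ≤ T²`: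
  `‖nN_β(n) − 1‖ ≤ ‖β‖·log n + ½e^{−𝓛³⁰}`;
* `norm_nN_sub_cpow_le_of_mul_le` — `‖nN_β(n) − n^{−β}‖ ≤ ½e^{−𝓛³⁰}` (the cutoff alone);
* the instance `4n ≤ T²` with `|β| ≤ 5α`:
  `‖nN_β(n) − 1‖ ≤ 5α·log(T²) + ½e^{−𝓛³⁰} = 10α𝓛^{11/10} + ½e^{−𝓛³⁰}` (`norm_nN_sub_one_le_of_four_mul_le`).

Theorems only (no definitions, no named facts); axioms standard. WHAT THIS IS NOT: any claim about
Theorems 1–2 of the source or about Landau–Siegel zeros.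

## References

* Y. Zhang, arXiv:2211.02515v1 (2022), §17 p. 97 (u014); §4 (4.2) p. 19. [cite: Zhang2022LandauSiegel, §17 u014 p.97]
-/

noncomputable section

open Complex Real
open Literature.NumberTheory.LFunctions.Zhang2022.Skeleton
open Literature.NumberTheory.LFunctions.Zhang2022.Typed.Section17

namespace Literature.NumberTheory.LFunctions.Zhang2022.Phi3Eval

variable {D : ℕ}

/-- **The cutoff alone**: for `𝓛 ≥ 1`, `n ≥ 1`, `e·n ≤ T²` and `Re β = 0`,
`‖nN_β(n) − n^{−β}‖ ≤ ½e^{−𝓛³⁰}` (`g*(y) = g(y)` for `y = T²/n ≥ e > ½`, `|g(y) − 1| ≤ ½e^{−𝓛³⁰log²y}`).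
[cite: Zhang2022LandauSiegel, §4 (4.2) p.19] -/
theorem norm_nN_sub_cpow_le_of_mul_le (hℓ : 1 ≤ ell D) {β : ℂ} (hβre : β.re = 0) {n : ℕ} (hn : n ≠ 0)
    (hnT : Real.exp 1 * (n : ℝ) ≤ bigT D ^ 2) :
    ‖nN D β n - (n : ℂ) ^ (-β)‖ ≤ (1 / 2 : ℝ) * Real.exp (-(ell D ^ 30)) := by
  have hn0 : (0 : ℝ) < n := by exact_mod_cast Nat.pos_of_ne_zero hn
  set y : ℝ := bigT D ^ 2 / n with hy
  have hye : Real.exp 1 ≤ y := by rw [hy, le_div_iff₀ hn0]; exact hnT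
  have he1 : (1 : ℝ) ≤ Real.exp 1 := by have := Real.add_one_le_exp (1 : ℝ); linarith
  have hy1 : 1 ≤ y := he1.trans hye
  have hlogy : 1 ≤ Real.log y := by
    have := Real.log_le_log (Real.exp_pos 1) hye
    rwa [Real.log_exp] at this
  have hg : gstar D y = gW D y := if_pos (by linarith)
  have hgW : |gW D y - 1| ≤ (1 / 2 : ℝ) * Real.exp (-(ell D ^ 30)) := by
    have h := GaussWeight.abs_gWeight_sub_one_le (by positivity : (0 : ℝ) < ell D ^ 30) hy1
    calc |gW D y - 1| ≤ (1 / 2) * Real.exp (-(ell D ^ 30) * (Real.log y) ^ 2) := h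
      _ ≤ (1 / 2) * Real.exp (-(ell D ^ 30)) := by
          gcongr
          have h30 : 0 ≤ ell D ^ 30 := by positivity
          nlinarith [one_le_pow₀ (M₀ := ℝ) hlogy (n := 2)]
  have hcpow1 : ‖(n : ℂ) ^ (-β)‖ = 1 := by
    rw [Complex.norm_natCast_cpow_of_pos (Nat.pos_of_ne_zero hn), Complex.neg_re, hβre, neg_zero,
      Real.rpow_zero]
  have hsplit : nN D β n - (n : ℂ) ^ (-β) = (n : ℂ) ^ (-β) * ((gstar D (bigT D ^ 2 / n) : ℂ) - 1) := by
    rw [nN]; ring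
  rw [hsplit, norm_mul, hcpow1, one_mul, ← hy, ← Complex.ofReal_one, ← Complex.ofReal_sub,
    Complex.norm_real, Real.norm_eq_abs, hg]
  exact hgW

/-- **`nN_β(n) = 1 + O(|β|log n + e^{−𝓛³⁰})` below the cutoff**: for `𝓛 ≥ 1`, `Re β = 0`, `n ≥ 1`,
`e·n ≤ T²`: `‖nN_β(n) − 1‖ ≤ ‖β‖·log n + ½e^{−𝓛³⁰}`. [cite: Zhang2022LandauSiegel, §17 u014 p.97] -/
theorem norm_nN_sub_one_le_of_mul_le (hℓ : 1 ≤ ell D) {β : ℂ} (hβre : β.re = 0) {n : ℕ} (hn : n ≠ 0)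
    (hnT : Real.exp 1 * (n : ℝ) ≤ bigT D ^ 2) :
    ‖nN D β n - 1‖ ≤ ‖β‖ * Real.log n + (1 / 2 : ℝ) * Real.exp (-(ell D ^ 30)) := by
  have h1 := norm_nN_sub_cpow_le_of_mul_le hℓ hβre hn hnT
  have h2 := norm_natCast_cpow_neg_sub_one_le hβre hn
  calc ‖nN D β n - 1‖ = ‖(nN D β n - (n : ℂ) ^ (-β)) + ((n : ℂ) ^ (-β) - 1)‖ := by ring_nf
    _ ≤ ‖nN D β n - (n : ℂ) ^ (-β)‖ + ‖(n : ℂ) ^ (-β) - 1‖ := norm_add_le _ _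
    _ ≤ (1 / 2 : ℝ) * Real.exp (-(ell D ^ 30)) + ‖β‖ * Real.log n := add_le_add h1 h2
    _ = ‖β‖ * Real.log n + (1 / 2 : ℝ) * Real.exp (-(ell D ^ 30)) := by ring

/-- The instance used for `m₂ ≤ T²/(4D⁴)`-type ranges: `Re β = 0`, `‖β‖ ≤ 5α`, `1 ≤ n`, `4n ≤ T²` ⇒
`‖nN_β(n) − 1‖ ≤ 10α·𝓛^{11/10} + ½e^{−𝓛³⁰}` (`log n ≤ log T² = 2𝓛^{11/10}`, `e ≤ 4`).
[cite: Zhang2022LandauSiegel, §17 u021 p.98] -/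
theorem norm_nN_sub_one_le_of_four_mul_le (hℓ : 1 ≤ ell D) {β : ℂ} (hβre : β.re = 0)
    (hβ : ‖β‖ ≤ 5 * alpha D) {n : ℕ} (hn : n ≠ 0) (hnT : 4 * (n : ℝ) ≤ bigT D ^ 2) :
    ‖nN D β n - 1‖ ≤ 10 * alpha D * ell D ^ (11 / 10 : ℝ) + (1 / 2 : ℝ) * Real.exp (-(ell D ^ 30)) := by
  have hn0 : (0 : ℝ) < n := by exact_mod_cast Nat.pos_of_ne_zero hn
  have he4 : Real.exp 1 ≤ 4 := by
    have := Real.exp_one_lt_d9; linarith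
  have hnT' : Real.exp 1 * (n : ℝ) ≤ bigT D ^ 2 := (mul_le_mul_of_nonneg_right he4 hn0.le).trans hnT
  refine (norm_nN_sub_one_le_of_mul_le hℓ hβre hn hnT').trans (add_le_add ?_ le_rfl)
  have hℓ0 : 0 < ell D := by linarith
  have hα0 : 0 ≤ alpha D := (alpha_pos' hℓ0).le
  have hT0 : 0 < bigT D := Real.exp_pos _
  have hlogn : Real.log n ≤ 2 * ell D ^ (11 / 10 : ℝ) := by
    have h4 : (n : ℝ) ≤ bigT D ^ 2 := by nlinarith
    calc Real.log n ≤ Real.log (bigT D ^ 2) := Real.log_le_log hn0 h4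
      _ = 2 * ell D ^ (11 / 10 : ℝ) := by rw [Real.log_pow, bigT, Real.log_exp]; push_cast; ring
  calc ‖β‖ * Real.log n ≤ (5 * alpha D) * (2 * ell D ^ (11 / 10 : ℝ)) :=
        mul_le_mul hβ hlogn (Real.log_natCast_nonneg n) (by positivity)
    _ = 10 * alpha D * ell D ^ (11 / 10 : ℝ) := by ring

end Literature.NumberTheory.LFunctions.Zhang2022.Phi3Eval
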